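import Summits.QuantumFields.YangMills.Theorems.UV3PinnedRestrictedStepV3
import Summits.QuantumFields.YangMills.Theorems.UV3PinnedStepOfPackage
import Summits.QuantumFields.YangMills.Theorems.AlphaInputsT3ACv3Core
import HarnessLib

/-!
# R3 (cell `ym3-torus`, YM₃ on T³ — a ladder RUNG, NOT d = 4, NOT the Clay problem), UV3-node side of `stub_pinnedStep` (R-19936-S), v3 currency —
# **ROW (S-i) IN T³ LETTERS OVER THE v3 CORE RECORD `PkgCoreV3`**: the pinned (41) for the route's restricted density `resDensity`, `dV`-a.e., with the
# WINDOWED pinned weights `wtP` of the v3 package, modulo the core rows (serves `PkgAtV3.toCore` AND `PkgAtV3Chi.toCore`)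

Seat `ym3-torus-px8` g11.  THEOREMS ONLY (0 `def`, 0 `sorry`); `--supports stmt-QuantumFields-19936 --as helper`; count-neutral.  The v3 twin of ✓p749282 `UV3PinnedStepOfPackage`
(★★OWNER WORD 58 (e)): same proof over ✓`UV3PinnedRestrictedStepV3.pinned41_above` with `σ_k := e^{−E}·resDensity(pin) k`, the core's `resDensity_ae_eq`∕`ineq41P_ae` (the v3 (41)_s
a.e.)∕`fibre55Win`∕`expo_succ`∕data rows, the (40) windows `admWindowT3` (measurable), and ✓`UV3PinnedStepOfPackage.resDensity_preimage_ae_eq_indicator_mul`∕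
`towerDensity_succ_eq_rnTransport` (cell tower = RN iteration).

WHAT IS PROVED (ns `…Theorems.UV3PinnedStepOfPackageV3`):
* ★★★ `AlphaInputsT3AC.PkgCoreV3.resDensity_pinned_le_sum_ae` — for `q : PkgCoreV3 F 𝔠 γ hγ hγ1 K`, pinned level `s` (`s + 1 ≤ K`), plaquette `a`, `θ ≥ eps1Of s`:
  at every `s + 1 ≤ k ≤ K`, `resDensity F γ K {U | θ ≤ dist1 (Ū^s U)(∂a)} k ≤ᵐ e^{E}·Σ_{h : a ∈ h(s) ∨ collar} q.wtP k h · e^{(41)_k exponent}`.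
* ★★★ `AlphaInputsT3AC.PkgCoreV3.resDensity_pinned_le_sumTop_ae` — at `k = K`, constants pulled out: `≤ᵐ exp(−(E_K − E) + Rm_K)·Σ_{pin} q.wtP K h·e^{−mainT+Pint+Zterm}`.

HONEST SCOPE.  Bookkeeping; CONDITIONAL on the v3 core rows exactly as `PkgCoreV3.ineq41P_ae` is; (S-ii), hJ, `stub_pinnedStep`, `hP′`, `HistoryTailL` (19936) NOT proved;
nothing continuum ∕ OS ∕ mass-gap ∕ Clay.
References: T. Bałaban, CMP **102** (1985) 255–275 [Balaban1985UV3] ((2) p. 256, (7)–(8) pp. 257–258, (40)–(41) p. 266, (48)–(49) pp. 267–268, Thm 2 p. 272).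
-/

set_option autoImplicit false

noncomputable section

namespace Summit.QuantumFields.YangMills.Theorems.UV3PinnedStepOfPackageV3

open MeasureTheory
open Literature.MathematicalPhysics.QuantumFieldTheory.Balaban1983to89
open Literature.MathematicalPhysics.QuantumFieldTheory.Balaban1983to89.AveragingRT (rnTransport)
open Literature.MathematicalPhysics.QuantumFieldTheory.Balaban1983to89.T3ContinuumYM3Torus
open Literature.MathematicalPhysics.QuantumFieldTheory.Balaban1983to89.T3UnitLawDensityEML (ℰp measurableE_ℰp emlDensity)
open Literature.MathematicalPhysics.QuantumFieldTheory.Balaban1983to89.T3RestrictedUnitDensity (towerDensity resDensity resDensity_nonneg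
  integrable_resDensity emlDensity_eq_towerDensity)
open Literature.MathematicalPhysics.QuantumFieldTheory.Balaban1985CMP102
open Literature.MathematicalPhysics.QuantumFieldTheory.Balaban1985CMP102.Setting
open Summit.QuantumFields.Balaban3D.Carriers
open Summit.QuantumFields.Balaban3D.Proofs.Primitives
open Summit.QuantumFields.Balaban3D.Proofs.TowerAC
open Summit.QuantumFields.Balaban3D.Proofs.StandardAC
open Summit.QuantumFields.Balaban3D.Proofs.Inputs
open Summit.QuantumFields.Balaban3D.Proofs.InputsAC
open Summit.QuantumFields.Balaban3D.Proofs.Bound55Masses (measurable_dev)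
open Summit.QuantumFields.YangMills.Theorems.UV3PinnedRestrictedStepV3 (pinned41_above)
open Summit.QuantumFields.YangMills.Theorems.UV3PinnedStepOfPackage (towerDensity_succ_eq_rnTransport resDensity_preimage_ae_eq_indicator_mul)

variable {F : T3Family} {𝔠 : AlphaConsts F.L (suGroupModel 2).N} {γ : ℝ} {hγ : 0 < γ} {hγ1 : γ ≤ (min 𝔠.gamma0 1) ^ 2} {K : ℕ}
  (q : AlphaInputsT3AC.PkgCoreV3 F 𝔠 γ hγ hγ1 K)

open Classical in
/-- ★★★ **ROW (S-i) OVER THE v3 CORE — THE PINNED (41) FOR THE ROUTE'S RESTRICTED DENSITY ABOVE THE PIN, WINDOWED WEIGHTS.**  For the core record `q` at `(γ, K)`,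
a pinned level `s` with `s + 1 ≤ K`, a level-`s` plaquette `a` and `θ ≥ eps1Of s`: at every `s + 1 ≤ k ≤ K`, `dV_k`-a.e.,
`resDensity F γ K {U | θ ≤ dist1 (Ū^s U)(∂a)} k ≤ e^{E}·Σ_{h : a ∈ h(s) ∨ ¬ plaqCover a ⊆ Ω_s(h↾s)} q.wtP k h · exp[−mainT_k + Pint_k − E_k + Zterm_k + Rm_k]`.
[cite: Balaban1985UV3, (2) p.256 + (7)-(8) pp.257-258 + (40)-(41) p.266 + (48)-(49) pp.267-268 + Thm 2 p.272] -/
theorem _root_.Summit.QuantumFields.YangMills.Theorems.AlphaInputsT3AC.PkgCoreV3.resDensity_pinned_le_sum_ae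
    (s : ℕ) (hs : s + 1 ≤ K) (a : Plaq (F.P K) s) (θ : ℝ)
    (hθ : eps1Of (T3Scales F γ hγ (hγ1.trans (sq_min_one_le _ 𝔠.gamma0_pos)) K) 𝔠.lane.carrier s ≤ θ) :
    ∀ (k : ℕ) (hsk : s + 1 ≤ k), k ≤ K → ∀ᵐ W ∂fieldMeasure (F.P K) k (Matrix.specialUnitaryGroup (Fin 2) ℂ),
      resDensity F γ K {U : GaugeField (F.P K) 0 (Matrix.specialUnitaryGroup (Fin 2) ℂ) |
          θ ≤ dist1 (GaugeField.plaqHol (Averaging.iter (fun i' => BlockAveraging.blockAvg (P := F.P K) (j := i') ℰp) s U) a)} k W ≤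
        Real.exp q.E *
          ∑ h ∈ Finset.univ.filter (fun h : Hist (F.P K) k =>
              a ∈ h ⟨s, hsk⟩ ∨ ¬ plaqCover a ⊆ Omega 𝔠.lane.carrier.M₁
                (rcolOf (T3Scales F γ hγ (hγ1.trans (sq_min_one_le _ 𝔠.gamma0_pos)) K) 𝔠.lane.carrier) s
                (fun j : Fin s => h (Fin.castLE (Nat.le_of_succ_le hsk) j)) s),
            q.wtP k h W *
              Real.exp (-(q.T.mainT k h W) + q.T.Pint k h W - q.T.Ecst k + q.T.Zterm k h + q.T.Rm k) := by
  intro k hsk hkK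
  have hγ0 : 0 ≤ γ := hγ.le
  set A : Set (GaugeField (F.P K) s (Matrix.specialUnitaryGroup (Fin 2) ℂ)) := {V | θ ≤ dist1 (GaugeField.plaqHol V a)} with hAdef
  have hA : MeasurableSet A := measurableSet_le measurable_const (measurable_dev a)
  set Ev : Set (GaugeField (F.P K) 0 (Matrix.specialUnitaryGroup (Fin 2) ℂ)) :=
    {U | θ ≤ dist1 (GaugeField.plaqHol (Averaging.iter (fun i' => BlockAveraging.blockAvg (P := F.P K) (j := i') ℰp) s U) a)} with hEdef
  have hEA : Ev = {U | Averaging.iter (fun i' => BlockAveraging.blockAvg (P := F.P K) (j := i') ℰp) s U ∈ A} := rfl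
  have hiter : Measurable (Averaging.iter (fun i' => BlockAveraging.blockAvg (P := F.P K) (j := i') ℰp) s) :=
    T4Continuum.measurable_iter _ (F.avgMeasurable_of_measurableE ℰp measurableE_ℰp K) s
  have hEm : MeasurableSet Ev := by rw [hEA]; exact hiter hA
  set σ : (k : ℕ) → Density (F.P K) k (Matrix.specialUnitaryGroup (Fin 2) ℂ) := fun k V => Real.exp (-q.E) * resDensity F γ K Ev k V with hσ
  have hσ0 : ∀ k U, 0 ≤ σ k U := fun k U => mul_nonneg (Real.exp_nonneg _) (resDensity_nonneg F γ K Ev k U)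
  have hσi : ∀ k, Integrable (σ k) (fieldMeasure (F.P K) k (Matrix.specialUnitaryGroup (Fin 2) ℂ)) := by
    intro k
    by_cases hk : k ≤ F.m + K
    · exact (integrable_resDensity F K (S := Ev) hEm hγ0 hk).const_mul _
    · have hz : resDensity F γ K Ev k = fun _ => 0 := by
        obtain ⟨k', rfl⟩ : ∃ k', k = k' + 1 := ⟨k - 1, by omega⟩
        unfold resDensity towerDensity
        rw [dif_neg hk]
      have : σ k = fun _ => 0 := by funext V; simp only [hσ, hz, mul_zero]
      rw [this]; exact integrable_const 0
  have hσT : ∀ k, s ≤ k → k + 1 ≤ (T3Scales F γ hγ (hγ1.trans (sq_min_one_le _ 𝔠.gamma0_pos)) K).K →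
      σ (k + 1) =ᵐ[fieldMeasure (F.P K) (k + 1) (Matrix.specialUnitaryGroup (Fin 2) ℂ)] rnTransport (q.X.av k).avg (σ k) := by
    intro k _ hk1
    have hk1' : k + 1 ≤ K := hk1
    have hstep : resDensity F γ K Ev (k + 1) = rnTransport (avT3 F K k).avg (resDensity F γ K Ev k) :=
      towerDensity_succ_eq_rnTransport F K _ (by omega)
    have hav : q.X.av k = avT3 F K k := rfl
    have hc := rnTransport_const_mul_ae (avT3 F K k).avg (resDensity F γ K Ev k) (resDensity_nonneg F γ K Ev k)
      (integrable_resDensity F K (S := Ev) hEm hγ0 (by omega)) (Real.exp_nonneg (-q.E))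
    rw [hav]
    filter_upwards [hc] with V hV
    show Real.exp (-q.E) * resDensity F γ K Ev (k + 1) V = rnTransport (avT3 F K k).avg (fun U => Real.exp (-q.E) * resDensity F γ K Ev k U) V
    rw [hV, hstep]
  have hσs : σ s ≤ᵐ[fieldMeasure (F.P K) s (Matrix.specialUnitaryGroup (Fin 2) ℂ)] fun U =>
      A.indicator (fun _ => (1 : ℝ)) U * q.T.ρ s U := by
    have h1 := resDensity_preimage_ae_eq_indicator_mul F K hγ0 s (by omega) A hA
    have h2 := q.resDensity_ae_eq s (by omega)
    have huniv : resDensity F γ K Set.univ s = emlDensity F γ K s := by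
      unfold resDensity
      rw [Set.indicator_univ, ← emlDensity_eq_towerDensity]
    rw [huniv] at h2
    rw [← hEA] at h1
    filter_upwards [h1, h2] with V hV1 hV2
    show Real.exp (-q.E) * resDensity F γ K Ev s V ≤ A.indicator (fun _ => (1 : ℝ)) V * q.T.ρ s V
    rw [hV1, hV2]
    have hee : Real.exp (-q.E) * Real.exp q.E = 1 := by rw [← Real.exp_add, neg_add_cancel, Real.exp_zero]
    have : Real.exp (-q.E) * (A.indicator (fun _ => (1 : ℝ)) V * (Real.exp q.E * q.T.ρ s V)) =
        A.indicator (fun _ => (1 : ℝ)) V * q.T.ρ s V := by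
      calc Real.exp (-q.E) * (A.indicator (fun _ => (1 : ℝ)) V * (Real.exp q.E * q.T.ρ s V))
          = (Real.exp (-q.E) * Real.exp q.E) * (A.indicator (fun _ => (1 : ℝ)) V * q.T.ρ s V) := by ring
        _ = _ := by rw [hee, one_mul]
    rw [this]
  have hmain := pinned41_above 𝔠.lane q.X q.𝔖 (AlphaInputsT3AC.admWindowT3 F 𝔠 γ hγ hγ1 K)
    (AlphaInputsT3AC.measurableSet_admWindowT3 F 𝔠 γ hγ hγ1 K) q.fibre55Win q.expo_succ
    (fun k hk => (q.runCore.steps k hk).hU) (fun k hk => (q.runCore.steps k hk).hPm)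
    (fun k hk => ⟨q.𝔄.cP k, (q.runCore.steps k hk).hPb⟩) s hs a θ hθ (q.ineq41P_ae s (by omega)) σ hσ0 hσi hσT hσs k hsk hkK
  filter_upwards [hmain] with W hW
  have hW' := mul_le_mul_of_nonneg_left hW (Real.exp_pos q.E).le
  have hlhs : Real.exp q.E * σ k W = resDensity F γ K Ev k W := by
    show Real.exp q.E * (Real.exp (-q.E) * resDensity F γ K Ev k W) = _
    rw [← mul_assoc, ← Real.exp_add, add_neg_cancel, Real.exp_zero, one_mul]
  rw [hlhs] at hW'
  exact hW'

open Classical in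
/-- ★★★ **ROW (S-i) AT THE UNIT LATTICE OVER THE v3 CORE, CONSTANTS PULLED OUT**: `dV_K`-a.e.,
`resDensity F γ K {U | θ ≤ dist1 (Ū^s U)(∂a)} K ≤ exp(−(E_K − E) + Rm_K)·Σ_{h : pinned ∨ collar} q.wtP K h W·exp[−mainT_K + Pint_K + Zterm_K]` (the `Ineq41AE` shape of
`PkgCoreV3.resDensity_le_sum_ae` with the history sum RESTRICTED to the pin family). [cite: Balaban1985UV3, (41) p.266 + Thm 2 p.272] -/
theorem _root_.Summit.QuantumFields.YangMills.Theorems.AlphaInputsT3AC.PkgCoreV3.resDensity_pinned_le_sumTop_ae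
    (s : ℕ) (hs : s + 1 ≤ K) (a : Plaq (F.P K) s) (θ : ℝ)
    (hθ : eps1Of (T3Scales F γ hγ (hγ1.trans (sq_min_one_le _ 𝔠.gamma0_pos)) K) 𝔠.lane.carrier s ≤ θ) :
    ∀ᵐ W ∂fieldMeasure (F.P K) K (Matrix.specialUnitaryGroup (Fin 2) ℂ),
      resDensity F γ K {U : GaugeField (F.P K) 0 (Matrix.specialUnitaryGroup (Fin 2) ℂ) |
          θ ≤ dist1 (GaugeField.plaqHol (Averaging.iter (fun i' => BlockAveraging.blockAvg (P := F.P K) (j := i') ℰp) s U) a)} K W ≤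
        Real.exp (-(q.T.Ecst K - q.E) + q.T.Rm K) *
          ∑ h ∈ Finset.univ.filter (fun h : Hist (F.P K) K =>
              a ∈ h ⟨s, hs⟩ ∨ ¬ plaqCover a ⊆ Omega 𝔠.lane.carrier.M₁
                (rcolOf (T3Scales F γ hγ (hγ1.trans (sq_min_one_le _ 𝔠.gamma0_pos)) K) 𝔠.lane.carrier) s
                (fun j : Fin s => h (Fin.castLE (Nat.le_of_succ_le hs) j)) s),
            q.wtP K h W * Real.exp (-(q.T.mainT K h W) + q.T.Pint K h W + q.T.Zterm K h) := by
  have hmain := q.resDensity_pinned_le_sum_ae s hs a θ hθ K hs le_rfl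
  filter_upwards [hmain] with W hW
  refine hW.trans (le_of_eq ?_)
  have hsplit : ∀ (x b c d r : ℝ), Real.exp (-x + b - c + d + r) = Real.exp (-c + r) * Real.exp (-x + b + d) := fun x b c d r => by
    rw [← Real.exp_add]; congr 1; ring
  have hE : Real.exp (-(q.T.Ecst K - q.E) + q.T.Rm K) = Real.exp q.E * Real.exp (-(q.T.Ecst K) + q.T.Rm K) := by
    rw [← Real.exp_add]; congr 1; ring
  rw [hE, mul_assoc, Finset.mul_sum, Finset.mul_sum, Finset.mul_sum]
  refine Finset.sum_congr rfl fun h _ => ?_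
  rw [hsplit]; ring

end Summit.QuantumFields.YangMills.Theorems.UV3PinnedStepOfPackageV3

end
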